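import Summits.BirchSwinnertonDyer.Rank1Residual.O5.SupersingularLocalClassUniqueThreeProofs
import Summits.BirchSwinnertonDyer.Rank1Residual.GaloisImage.PsiThreeKummerQuarticShapeIII
import Literature.NumberTheory.EllipticCurves.NeronComponentIndexTypeIIIProofs
import HarnessLib

/-!
# T19a SHARPENED: one local projective `3`-torsion class on the whole tame locus `SubTprime` (`III` too)
# (cell `b2b-bsdres`, team n1011, row T-SSQ3 addendum A1, seat n1011-p05 GEN 11, FILE F4b — END)

HONEST FRAMING (cell `b2b-bsdres`, run/shared/lean/b2b/bsd-rank1-residual/, verbatim in every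
file): the goal of the cell is to DELETE the COMBINATION-SHAPED residual classes of the
Birch–Swinnerton-Dyer formula for ALL analytic-rank `≤ 1` elliptic curves over `ℚ` — "full BSD
formula for every rank `≤ 1` curve in class `C`" assembled STRICTLY from published theorems — so
that the rank-`≤ 1` remainder becomes exactly the CONSTRUCTION-SHAPED classes, which are TYPED
(missing-input `Prop`s), NOT attempted. This is not "finishing BSD". Team n1011; row T-SSQ3
(`cells/n1011/skel/T-SSQ3.md`), ADDENDUM A1. TOOL/END theorems only — no definition, no named fact,
no `sorry`; closes NO pair, moves NO mark (O5 OPEN); nothing booked.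

## What

FILE F3b proved T19a `O5.SupersingularLocalClassUniqueThree` AS TYPED: curves that are good at `3` or
`III*` at `3` (`ClassO5 ∧ SubTprime ∧ v₃Δ = 9`), with `Ψ₃` rootless over `ℚ₃`, all have
`ℚ₃(x(P)) ≅ ℚ₃(3^{1/4})`. The node's docstring (o5-r1 GEN 6 v2 Thm 2, AMENDMENT 2) says the Kodaira-`III`
curves (`v₃Δ = 3`) carry the TWISTED linear class `V₁ = V₀ ⊗ ω` — the SAME projective class. This file
proves the corresponding sharpening in the kernel, dropping the binder `padicValRat 3 Δ = 9`:

* `exists_IIIForm` — Kodaira `III` at `3` ⟹ Tate's normal form `3∣a₁, 3∣a₂, 3∣a₃, 3∥a₄, 9∣a₆` over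
  `ℤ₃` for a `ℚ₃`-model of `E` (tree `exists_smul_of_kodairaSymbolOfMinimal_eq_III`);
* `kummerShape_of_kodairaSymbolAt_III` — with `Ψ₃` rootless: `9 ∣ b₂` (F4a, Hensel), `Ψ₃/3`
  Eisenstein, `Ψ₃` irreducible over `ℚ₃` with the root `ϖζ ∈ K₄` (F4a), transported back (F2a);
* `kummerShape_of_subTprime` — `ClassO5 ∧ SubTprime` (`III` or `III*`, tree
  `subTprime_three_iff_kodairaSymbolAt_III_or_IIIstar`) with `Ψ₃` rootless ⟹ the Kummer shape;
* END `sameDivisionQuarticAtThree_of_subTprime_or_good` — T19a with the `III*` clause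
  `ClassO5 ∧ SubTprime ∧ v₃Δ = 9` weakened to `ClassO5 ∧ SubTprime`: ONE local projective class on
  {good supersingular} ∪ {`III`} ∪ {`III*`} (all with `E[3]|G_{ℚ₃}` irreducible); T19a itself is the landed
  `supersingularLocalClassUniqueThree_holds` (F3b), a special case.

Not claimed: the `I₀*`-supersingular class `SubGss` (same projective class by o5-r1's Thm 2; its
`ℤ₃`-shape needs the twist dictionary — a further addendum), and any LINEAR-class statement.

References: J. H. Silverman, *ATAEC* IV.9.4 Steps 4 and 9, Table 4.1 [SilvermanATAEC1994]; J.-P. Serre,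
Invent. Math. 15 (1972) §1.11 (motivation) [Serre1972]; cells/n1011/skel/T-SSQ3.md.
-/

noncomputable section

open scoped Classical

open Polynomial WeierstrassCurve IsDedekindDomain IsDedekindDomain.HeightOneSpectrum NumberField
  Literature.NumberTheory.DiophantineGeometry Literature.NumberTheory.DiophantineGeometry.TateAlgorithm
  Literature.NumberTheory.EllipticCurves Literature.NumberTheory.EllipticCurves.LocalIndex
  Summit.BirchSwinnertonDyer.Rank1Residual.Additive
  Summit.BirchSwinnertonDyer.Rank1Residual.GaloisImage.QuarticKummerThree
  Summit.BirchSwinnertonDyer.Rank1Residual.GaloisImage.PsiThreeKummer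

namespace Summit.BirchSwinnertonDyer.Rank1Residual.O5

variable (E : WeierstrassCurve ℚ) [E.IsElliptic] [E.IsGloballyMinimal]

/-! ## §1 Kodaira `III` at `3` -/

omit [E.IsGloballyMinimal] in
/-- **Tate's normal form of type `III` over `ℤ₃` for `E`**: a change of model `C` over `ℚ₃` and a
`ℤ₃`-model `J` with `C • (E ⊗ ℚ₃) = J ⊗ ℚ₃`, `a₁ = 3α₁, a₂ = 3α₂, a₃ = 3α₃, a₄ = 3α₄` with `α₄` a unit,
`a₆ = 9α₆` (tree `exists_smul_of_kodairaSymbolOfMinimal_eq_III` on the `ℤ₃`-minimal model, Kodaira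
symbol transported by `kodairaSymbolAt_eq_padic`). [cite: SilvermanATAEC1994, IV.9.4 Step 4] -/
theorem exists_IIIForm [Fact (Nat.Prime 3)] (hK : E.kodairaSymbolAt (placeOf 3) = .III) :
    ∃ (C : VariableChange ℚ_[3]) (J : WeierstrassCurve ℤ_[3]) (α₁ α₂ α₃ α₄ α₆ : ℤ_[3]),
      C • E.baseChange ℚ_[3] = J.map (algebraMap ℤ_[3] ℚ_[3]) ∧
      J.a₁ = 3 * α₁ ∧ J.a₂ = 3 * α₂ ∧ J.a₃ = 3 * α₃ ∧ J.a₄ = 3 * α₄ ∧ IsUnit α₄ ∧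
      J.a₆ = 9 * α₆ := by
  haveI : Finite (IsLocalRing.ResidueField ℤ_[3]) :=
    Finite.of_equiv _ (PadicInt.residueField (p := 3)).toEquiv.symm
  haveI : PerfectField (IsLocalRing.ResidueField ℤ_[3]) := PerfectField.ofFinite
  -- the Kodaira symbol over `ℤ₃`
  have hq : Rat.HeightOneSpectrum.primesEquiv (R := ℤ) (placeOf 3) = ⟨3, Nat.prime_three⟩ :=
    (Rat.HeightOneSpectrum.primesEquiv (R := ℤ)).apply_symm_apply ⟨3, Nat.prime_three⟩
  have key : ∀ q : Nat.Primes, q = ⟨3, Nat.prime_three⟩ →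
      (haveI : Fact q.1.Prime := ⟨q.2⟩
       (E.baseChange ℚ_[q]).kodairaSymbol ℤ_[q] = .III) →
      (E.baseChange ℚ_[3]).kodairaSymbol ℤ_[3] = .III := by
    rintro _ rfl h; exact h
  have hpadic : (E.baseChange ℚ_[3]).kodairaSymbol ℤ_[3] = .III := by
    refine key _ hq ?_
    rw [← kodairaSymbolAt_eq_padic (placeOf 3) E]
    exact hK
  -- Tate's normal form on the minimal `ℤ₃`-model
  set M₀ := ((E.baseChange ℚ_[3]).minimal ℤ_[3]).integralModel ℤ_[3] with hM₀
  have hKM : M₀.kodairaSymbolOfMinimal = .III := hpadic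
  obtain ⟨D, h1, h2, h3, h4, h4', h6⟩ := exists_smul_of_kodairaSymbolOfMinimal_eq_III M₀ hKM
  obtain ⟨C₀, hC₀⟩ := exists_smul_eq_map_minimal E
  obtain ⟨α₁, hα₁⟩ := pow_dvd_of_mem_maximalIdeal_pow (k := 1) (a := (D • M₀).a₁) (by rwa [pow_one])
  obtain ⟨α₂, hα₂⟩ := pow_dvd_of_mem_maximalIdeal_pow (k := 1) (a := (D • M₀).a₂) (by rwa [pow_one])
  obtain ⟨α₃, hα₃⟩ := pow_dvd_of_mem_maximalIdeal_pow (k := 1) (a := (D • M₀).a₃) (by rwa [pow_one])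
  obtain ⟨α₄, hα₄⟩ := pow_dvd_of_mem_maximalIdeal_pow (k := 1) (a := (D • M₀).a₄) (by rwa [pow_one])
  obtain ⟨α₆, hα₆⟩ := pow_dvd_of_mem_maximalIdeal_pow h6
  have hα₄u : IsUnit α₄ := by
    rw [isUnit_iff_not_three_dvd]
    rintro ⟨c, hc⟩
    refine h4' (mem_maximalIdeal_pow_of_pow_dvd ⟨c, ?_⟩)
    rw [hα₄, hc]; ring
  refine ⟨D.map (algebraMap ℤ_[3] ℚ_[3]) * C₀, D • M₀, α₁, α₂, α₃, α₄, α₆, ?_,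
    by rw [hα₁]; ring, by rw [hα₂]; ring, by rw [hα₃]; ring, by rw [hα₄]; ring, hα₄u,
    by rw [hα₆]; ring⟩
  rw [mul_smul, hC₀, map_variableChange]

omit [E.IsGloballyMinimal] in
/-- **(III) At a place of Kodaira type `III` with `Ψ₃` rootless over `ℚ₃`: `Ψ₃^E` is irreducible over
`ℚ₃` and has a root in `K₄ = ℚ₃(3^{1/4})`.** On Tate's form `b₂ = 3γ, b₄ = 3γ₄, b₆ = 3γ₆, b₈ = 9γ₈`
with `3 ∣ γ₈ + 1`; rootless ⟹ `3 ∣ γ` (F4a, Hensel); then the `III` shape of F4a applies and the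
conclusion transports back (F2a). [cite: SilvermanATAEC1994, IV.9.4 Step 4] -/
theorem kummerShape_of_kodairaSymbolAt_III [Fact (Nat.Prime 3)]
    (hK : E.kodairaSymbolAt (placeOf 3) = .III)
    (hroot : ∀ r : ℚ_[3], ¬ ((E.baseChange ℚ_[3]).Ψ₃).IsRoot r) :
    Irreducible (E.baseChange ℚ_[3]).Ψ₃ ∧
      ∃ x : AdjoinRoot (X ^ 4 - Polynomial.C (3 : ℚ_[3])), aeval x (E.baseChange ℚ_[3]).Ψ₃ = 0 := by
  obtain ⟨C, J, α₁, α₂, α₃, α₄, α₆, hCJ, ha₁, ha₂, ha₃, ha₄, hα₄, ha₆⟩ := exists_IIIForm E hK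
  have hrootJ := forall_not_isRoot_of_smul_eq_map E hCJ hroot
  have hb₂ : J.b₂ = 3 * (3 * α₁ ^ 2 + 4 * α₂) := IIIForm.b₂_eq J ha₁ ha₂
  have hb₄ : J.b₄ = 3 * (2 * α₄ + 3 * α₁ * α₃) := IIIForm.b₄_eq J ha₁ ha₃ ha₄
  have hb₆ : J.b₆ = 3 * (3 * α₃ ^ 2 + 12 * α₆) := IIIForm.b₆_eq J ha₃ ha₆
  have hb₈ : J.b₈ =
      9 * (9 * α₁ ^ 2 * α₆ + 12 * α₂ * α₆ - 3 * α₁ * α₃ * α₄ + 3 * α₂ * α₃ ^ 2 - α₄ ^ 2) :=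
    IIIForm.b₈_eq J ha₁ ha₂ ha₃ ha₄ ha₆
  have hγ₈ := IIIForm.three_dvd_γ₈_add_one (α₁ := α₁) (α₂ := α₂) (α₃ := α₃) (α₆ := α₆) hα₄
  -- rootless ⟹ `9 ∣ b₂`
  obtain ⟨γ₂, hγ₂⟩ := three_dvd_of_IIIShape_of_forall_not_isRoot J hb₂ hb₄ hb₆ hb₈ hrootJ
  have hb₂' : J.b₂ = 9 * γ₂ := by rw [hb₂, hγ₂]; ring
  have hIII := irreducible_and_exists_kummerRoot_Ψ₃_of_IIIShape J hb₂' hb₄ hb₆ hb₈ hγ₈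
  exact kummerShape_of_smul_eq_map E hCJ hIII.1 hIII.2

/-- **On the whole cell `(t′)` at `3` (`ClassO5 ∧ SubTprime`, Kodaira `III` or `III*`) with `Ψ₃`
rootless over `ℚ₃`: `Ψ₃^E` is irreducible over `ℚ₃` with a root in `K₄ = ℚ₃(3^{1/4})`.**
[cite: SilvermanATAEC1994, IV.9.4 Steps 4 and 9] -/
theorem kummerShape_of_subTprime (h5 : ClassO5 E 3) (ht : SubTprime E 3)
    (hroot : ∀ r : ℚ_[3], ¬ ((E.baseChange ℚ_[3]).Ψ₃).IsRoot r) :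
    Irreducible (E.baseChange ℚ_[3]).Ψ₃ ∧
      ∃ x : AdjoinRoot (X ^ 4 - Polynomial.C (3 : ℚ_[3])), aeval x (E.baseChange ℚ_[3]).Ψ₃ = 0 := by
  haveI : Fact (Nat.Prime 3) := ⟨Nat.prime_three⟩
  rcases (subTprime_three_iff_kodairaSymbolAt_III_or_IIIstar E h5.2.1).mp ht with h | h
  · exact kummerShape_of_kodairaSymbolAt_III E h hroot
  · exact kummerShape_of_kodairaSymbolAt_IIIstar E h hroot

/-- **Per curve, sharpened**: on `(ClassO5 ∧ SubTprime) ∨ 3 ∤ N` with `Ψ₃` rootless over `ℚ₃`,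
`Ψ₃^E` is irreducible over `ℚ₃` with a root in `K₄` — `ℚ₃(x(P)) ≅ ℚ₃(3^{1/4})`. [folklore] -/
theorem kummerShape_of_subTprime_or_good
    (hE : (ClassO5 E 3 ∧ SubTprime E 3) ∨ ¬ (3 ∣ E.conductorNorm ℤ))
    (hroot : ∀ r : ℚ_[3], ¬ ((E.baseChange ℚ_[3]).Ψ₃).IsRoot r) :
    Irreducible (E.baseChange ℚ_[3]).Ψ₃ ∧
      ∃ x : AdjoinRoot (X ^ 4 - Polynomial.C (3 : ℚ_[3])), aeval x (E.baseChange ℚ_[3]).Ψ₃ = 0 := by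
  rcases hE with ⟨h5, ht⟩ | hN
  · exact kummerShape_of_subTprime E h5 ht hroot
  · exact kummerShape_of_not_dvd_conductorNorm E hN hroot

/-! ## §2 END — T19a on the whole tame locus -/

/-- **T19a SHARPENED (the `v₃Δ = 9` binder dropped)**: any two curves over `ℚ`, each good at `3` or in
the cell `(t′)` (`ClassO5 ∧ SubTprime`: Kodaira `III` OR `III*`), both with `Ψ₃` rootless over `ℚ₃`,
satisfy `SameDivisionQuarticAtThree`: `Ψ₃^E` is irreducible over `ℚ₃` and `Ψ₃^{E'}` has a root in
`ℚ₃[X]/(Ψ₃^E)` — both quartics cut out `ℚ₃(3^{1/4})`. [cite: SilvermanATAEC1994, IV.9.4 Steps 4 and 9] -/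
theorem sameDivisionQuarticAtThree_of_subTprime_or_good (E E' : WeierstrassCurve ℚ) [E.IsElliptic]
    [E.IsGloballyMinimal] [E'.IsElliptic] [E'.IsGloballyMinimal]
    (hE : (ClassO5 E 3 ∧ SubTprime E 3) ∨ ¬ (3 ∣ E.conductorNorm ℤ))
    (hE' : (ClassO5 E' 3 ∧ SubTprime E' 3) ∨ ¬ (3 ∣ E'.conductorNorm ℤ))
    (hr : ∀ r : ℚ_[3], ¬ ((E.baseChange ℚ_[3]).Ψ₃).IsRoot r)
    (hr' : ∀ r : ℚ_[3], ¬ ((E'.baseChange ℚ_[3]).Ψ₃).IsRoot r) :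
    SameDivisionQuarticAtThree E E' := by
  obtain ⟨hirr, x, hx⟩ := kummerShape_of_subTprime_or_good E hE hr
  obtain ⟨-, x', hx'⟩ := kummerShape_of_subTprime_or_good E' hE' hr'
  exact ⟨hirr, exists_aeval_eq_zero_of_roots_in_kummerField hirr
    ((E.baseChange ℚ_[3]).natDegree_Ψ₃ (by norm_num)) hx hx'⟩

end Summit.BirchSwinnertonDyer.Rank1Residual.O5

end
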